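import Summits.Ventures.WeilGRH.TwistedColumns
import Summits.RiemannHypothesis.RiemannHypothesis.Theorems.WeilFormatCTailOdd
import HarnessLib

/-!
# GRH arm (rh-explicit, venture WeilGRH): L-C3b order 1 for a character, odd sector — the explicit TAIL MAJORANT `U₂⁻`
  for the kernel `twistedGramCoeff χ a`

Cell `rh-explicit`, WEIL TRACK — GRH ARM (lit/typing seat weil-grh-5 gen11).  Twisted copy of weil-10's
`WeilFormatCTailOdd.lean` (FORMATC-DESIGN §9.5): from `TwistedColumns.abs_oddTwistedKernel_col_sub_le`
(`|M⁻(i,m) − (−1)^{i+m} v⁻_χ(i)/m| ≤ κ⁻_χ(i)/m²`, modes `i = k+1`, `m = l+1`) and weil-10's `WeilFormatC.tailMajorant`, for far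
weights `d_l ≥ d₀ > 0` on `l ≥ B₃` (`2B ≤ B₃`, `1 ≤ B₃`) and every `N`, `x`:

  `Σ_{l∈Ico B₃ N} (Σ_{k<B} M⁻(k,l) x_k)²/d_l ≤ (1+θ)/(d₀B₃)·(Σ_k (−1)^{k+1}v⁻_χ(k+1) x_k)² + (1+θ⁻¹)·B/(d₀(B₃+1)²B₃)·Σ_k κ⁻_χ(k+1)² x_k²`,

`v⁻_χ(i) = −Σ_j Re χ(j)(Λ_j/√j) sin(ω_i log j)/π − Im ψ(¼+iω_i/2)/(2π) + T_i/π`, `κ⁻_χ(i) = 2iΛΣ/π + i/2 + 4a(1+E)/(3π²)` (no pole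
terms); `odd_twisted_tail_majorant_matrix` restates it as `xᵀU₂⁻x` — hypothesis `hU₂` of
`WeilFormatC.sum_range_mul_mul_nonneg_of_certificate_sum_split` for the odd sector of a character.
Standard axioms; no definitions; no named facts; RH/GRH-free.
-/

set_option autoImplicit false

noncomputable section

open Complex Finset Matrix
open scoped Real BigOperators ArithmeticFunction.vonMangoldt

namespace Summit.Ventures.WeilGRH

open Literature.NumberTheory.LFunctions
open Literature.NumberTheory.LFunctions.Yoshida1992 (freq incrCoeff archCoeff archExpSumSin)
open Literature.Analysis.SpecialFunctions
open Summit.RiemannHypothesis.RiemannHypothesis.Theorems.WeilFormatC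

variable {q : ℕ} {a : ℝ}

section Tail

/-- **Odd tail majorant (order 1) for a character.**  See the module docstring; the kernel is the odd SectorSplit kernel
of `twistedGramCoeff χ a` on kernel indices (`k` row, `l` column; modes `k+1`, `l+1`). -/
theorem odd_twisted_tail_majorant (χ : DirichletCharacter ℂ q) (ha : 0 < a) {B B₃ : ℕ} (hBB : 2 * B ≤ B₃)
    (hB₃ : 1 ≤ B₃) (d : ℕ → ℝ) {d₀ : ℝ} (hd₀ : 0 < d₀) (hd : ∀ l, B₃ ≤ l → d₀ ≤ d l) {θ : ℝ} (hθ : 0 < θ)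
    (N : ℕ) (x : Fin B → ℝ) :
    ∑ l ∈ Finset.Ico B₃ N, (∑ k : Fin B,
        ((twistedGramCoeff χ a (((k : ℕ) : ℤ) + 1) ((l : ℤ) + 1) -
          twistedGramCoeff χ a (((k : ℕ) : ℤ) + 1) (-((l : ℤ) + 1))) / 2) * x k) ^ 2 / d l
      ≤ (1 + θ) * (1 / (d₀ * B₃)) *
          (∑ k : Fin B, ((-1 : ℝ) ^ ((k : ℕ) + 1) *
            (-(∑ j ∈ weilPrimeIndex a, (χ (j : ZMod q)).re * ((Λ j : ℝ) / Real.sqrt j) *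
                  Real.sin (freq a (((k : ℕ) : ℤ) + 1) * Real.log j)) / π
              - (Complex.digamma (1 / 4 + ((freq a (((k : ℕ) : ℤ) + 1) : ℝ) : ℂ) / 2 * I)).im / (2 * π)
              + archExpSumSin a (((k : ℕ) : ℤ) + 1) / π)) * x k) ^ 2
        + (1 + θ⁻¹) * (B / (d₀ * ((((B₃ : ℝ) + 1) ^ 2) * (B₃ : ℝ))))
            * ∑ k : Fin B, (2 * ((k : ℕ) + 1 : ℕ) * (∑ j ∈ weilPrimeIndex a, (Λ j : ℝ) / Real.sqrt j) / π
                + ((((k : ℕ) + 1 : ℕ) : ℝ) / 2 + 4 * a * (1 + weilArchDensity (2 * a)) / (3 * π ^ 2))) ^ 2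
              * x k ^ 2 := by
  set T := Finset.Ico B₃ N with hT
  set LS := ∑ j ∈ weilPrimeIndex a, (Λ j : ℝ) / Real.sqrt j with hLS
  -- block-row structured coefficient V(k) (mode i = k+1) and the decomposition
  set V : Fin B → ℝ := fun k ↦
    -(∑ j ∈ weilPrimeIndex a, (χ (j : ZMod q)).re * ((Λ j : ℝ) / Real.sqrt j) *
        Real.sin (freq a (((k : ℕ) : ℤ) + 1) * Real.log j)) / π
      - (Complex.digamma (1 / 4 + ((freq a (((k : ℕ) : ℤ) + 1) : ℝ) : ℂ) / 2 * I)).im / (2 * π)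
      + archExpSumSin a (((k : ℕ) : ℤ) + 1) / π with hV
  set bcol : ℕ → Fin B → ℝ := fun l k ↦
    (twistedGramCoeff χ a (((k : ℕ) : ℤ) + 1) ((l : ℤ) + 1) -
      twistedGramCoeff χ a (((k : ℕ) : ℤ) + 1) (-((l : ℤ) + 1))) / 2 with hbcol
  set φ : Fin 1 → ℕ → ℝ := fun _ l ↦ (-1 : ℝ) ^ (l + 1) / ((l : ℝ) + 1) with hφ
  set v : Fin 1 → Fin B → ℝ := fun _ k ↦ (-1 : ℝ) ^ ((k : ℕ) + 1) * V k with hv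
  set r : ℕ → Fin B → ℝ := fun l k ↦ bcol l k - ∑ e : Fin 1, v e k * φ e l with hr
  set κ : Fin B → ℝ := fun k ↦ 2 * ((k : ℕ) + 1 : ℕ) * LS / π
      + ((((k : ℕ) + 1 : ℕ) : ℝ) / 2 + 4 * a * (1 + weilArchDensity (2 * a)) / (3 * π ^ 2)) with hκ
  have hTl : ∀ l ∈ T, B₃ ≤ l := fun l hl ↦ (Finset.mem_Ico.mp hl).1
  have hw : ∀ l ∈ T, 0 ≤ 1 / d l := fun l hl ↦ by
    have := hd l (hTl l hl); have : 0 < d l := lt_of_lt_of_le hd₀ this; positivity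
  have hb : ∀ l ∈ T, ∀ k, bcol l k = (∑ e : Fin 1, v e k * φ e l) + r l k := fun l _ k ↦ by
    simp only [hr]; ring
  have hrb : ∀ l ∈ T, ∀ k : Fin B, |r l k| ≤ κ k * (1 / ((l : ℝ) + 1) ^ 2) := by
    intro l hl k
    have hlB := hTl l hl
    have hi1 : 1 ≤ (k : ℕ) + 1 := by omega
    have h2i : 2 * ((k : ℕ) + 1) ≤ l + 1 := by have := k.isLt; omega
    have h := abs_oddTwistedKernel_col_sub_le χ ha hi1 h2i
    have e : r l k = bcol l k - (-1 : ℝ) ^ ((((k : ℕ) + 1 : ℕ) : ℤ) + ((l + 1 : ℕ) : ℤ)) * V k / ((l + 1 : ℕ) : ℝ) := by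
      simp only [hr, hv, hφ, Finset.univ_unique, Fin.default_eq_zero, Finset.sum_singleton]
      rw [show ((((k : ℕ) + 1 : ℕ) : ℤ) + ((l + 1 : ℕ) : ℤ)) = ((((k : ℕ) + 1) + (l + 1) : ℕ) : ℤ) by push_cast; ring,
        zpow_natCast, pow_add]
      push_cast
      ring
    rw [e, hbcol, hV]
    refine h.trans (le_of_eq ?_)
    simp only [hκ, hLS]
    push_cast
    ring
  have hmaj := tailMajorant T bcol r v φ (fun l ↦ 1 / d l) (fun l ↦ 1 / ((l : ℝ) + 1) ^ 2) κ x hθ hw hb hrb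
  simp only [Finset.univ_unique, Fin.default_eq_zero, Finset.sum_singleton, Fintype.card_fin] at hmaj
  have hlhs : ∑ l ∈ T, (∑ k : Fin B, bcol l k * x k) ^ 2 / d l = ∑ l ∈ T, 1 / d l * (∑ k : Fin B, bcol l k * x k) ^ 2 :=
    Finset.sum_congr rfl fun l _ ↦ by ring
  rw [hlhs]
  refine hmaj.trans ?_
  -- tail sums
  have hF : ∑ l ∈ T, 1 / d l * φ 0 l * φ 0 l ≤ 1 / (d₀ * B₃) := by
    have hterm : ∀ l ∈ T, 1 / d l * φ 0 l * φ 0 l ≤ 1 / d₀ * (1 / ((l : ℝ) + 1) ^ 2) := by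
      intro l hl
      have hdl := hd l (hTl l hl)
      have hsq : φ 0 l * φ 0 l = 1 / ((l : ℝ) + 1) ^ 2 := by
        simp only [hφ]
        rw [div_mul_div_comm, ← sq, ← pow_mul, Nat.mul_comm, pow_mul, neg_one_sq, one_pow, sq]
      rw [mul_assoc, hsq]
      exact mul_le_mul_of_nonneg_right (one_div_le_one_div_of_le hd₀ hdl) (by positivity)
    refine (Finset.sum_le_sum hterm).trans ?_
    rw [← Finset.mul_sum]
    calc 1 / d₀ * ∑ l ∈ T, 1 / ((l : ℝ) + 1) ^ 2 ≤ 1 / d₀ * (1 / (B₃ : ℝ)) :=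
          mul_le_mul_of_nonneg_left (sum_Ico_inv_succ_sq_le hB₃ N) (by positivity)
      _ = 1 / (d₀ * B₃) := by rw [one_div_mul_one_div]
  have hG : ∑ l ∈ T, 1 / d l * (1 / ((l : ℝ) + 1) ^ 2) ^ 2 ≤ 1 / (d₀ * ((((B₃ : ℝ) + 1) ^ 2) * (B₃ : ℝ))) := by
    have hterm : ∀ l ∈ T, 1 / d l * (1 / ((l : ℝ) + 1) ^ 2) ^ 2 ≤ 1 / d₀ * (1 / ((l : ℝ) + 1) ^ 4) := by
      intro l hl
      have hdl := hd l (hTl l hl)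
      have e : (1 / ((l : ℝ) + 1) ^ 2) ^ 2 = 1 / ((l : ℝ) + 1) ^ 4 := by rw [_root_.one_div_pow, ← pow_mul]
      rw [e]
      exact mul_le_mul_of_nonneg_right (one_div_le_one_div_of_le hd₀ hdl) (by positivity)
    refine (Finset.sum_le_sum hterm).trans ?_
    rw [← Finset.mul_sum]
    calc 1 / d₀ * ∑ l ∈ T, 1 / ((l : ℝ) + 1) ^ 4 ≤ 1 / d₀ * (1 / ((((B₃ : ℝ) + 1) ^ 2) * (B₃ : ℝ))) :=
          mul_le_mul_of_nonneg_left (sum_Ico_inv_succ_pow_four_le hB₃ N) (by positivity)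
      _ = 1 / (d₀ * ((((B₃ : ℝ) + 1) ^ 2) * (B₃ : ℝ))) := by rw [one_div_mul_one_div]
  have hsq0 : 0 ≤ (∑ k : Fin B, v 0 k * x k) * (∑ k : Fin B, v 0 k * x k) := mul_self_nonneg _
  have hρ0 : 0 ≤ (B : ℝ) * ∑ k : Fin B, κ k ^ 2 * x k ^ 2 := by
    have : 0 ≤ ∑ k : Fin B, κ k ^ 2 * x k ^ 2 := Finset.sum_nonneg fun k _ ↦ by positivity
    positivity
  have h1 : (1 + θ) * ((∑ l ∈ T, 1 / d l * φ 0 l * φ 0 l) * ((∑ k : Fin B, v 0 k * x k) * (∑ k : Fin B, v 0 k * x k)))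
      ≤ (1 + θ) * (1 / (d₀ * B₃) * ((∑ k : Fin B, v 0 k * x k) * (∑ k : Fin B, v 0 k * x k))) :=
    mul_le_mul_of_nonneg_left (mul_le_mul_of_nonneg_right hF hsq0) (by positivity)
  have h2 : (1 + θ⁻¹) * (∑ l ∈ T, 1 / d l * (1 / ((l : ℝ) + 1) ^ 2) ^ 2) * ((B : ℝ) * ∑ k : Fin B, κ k ^ 2 * x k ^ 2)
      ≤ (1 + θ⁻¹) * (1 / (d₀ * ((((B₃ : ℝ) + 1) ^ 2) * (B₃ : ℝ)))) * ((B : ℝ) * ∑ k : Fin B, κ k ^ 2 * x k ^ 2) := by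
    have hθ1 : 0 ≤ 1 + θ⁻¹ := by positivity
    exact mul_le_mul_of_nonneg_right (mul_le_mul_of_nonneg_left hG hθ1) hρ0
  refine (add_le_add h1 h2).trans (le_of_eq ?_)
  simp only [hv, hκ, hV]
  rw [← sq]
  ring

/-- Matrix form: **`hU₂` of `sum_range_mul_mul_nonneg_of_certificate_sum_split`** for the odd sector of a character,
`Σ_{l∈Ico B₃ N} (Σ_k M⁻(k,l) x_k)²/d_l ≤ xᵀU₂⁻x` with the explicit
`U₂⁻ = (1+θ)/(d₀B₃)·vvᵀ + (1+θ⁻¹)B/(d₀(B₃+1)²B₃)·diag(κ⁻_χ²)`, `v_k = (−1)^{k+1}v⁻_χ(k+1)`. -/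
theorem odd_twisted_tail_majorant_matrix (χ : DirichletCharacter ℂ q) (ha : 0 < a) {B B₃ : ℕ} (hBB : 2 * B ≤ B₃)
    (hB₃ : 1 ≤ B₃) (d : ℕ → ℝ) {d₀ : ℝ} (hd₀ : 0 < d₀) (hd : ∀ l, B₃ ≤ l → d₀ ≤ d l) {θ : ℝ} (hθ : 0 < θ)
    (N : ℕ) (x : Fin B → ℝ) :
    ∑ l ∈ Finset.Ico B₃ N, (∑ k : Fin B,
        ((twistedGramCoeff χ a (((k : ℕ) : ℤ) + 1) ((l : ℤ) + 1) -
          twistedGramCoeff χ a (((k : ℕ) : ℤ) + 1) (-((l : ℤ) + 1))) / 2) * x k) ^ 2 / d l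
      ≤ x ⬝ᵥ (Matrix.of fun k k' : Fin B ↦
          (1 + θ) * (1 / (d₀ * B₃)) *
            (((-1 : ℝ) ^ ((k : ℕ) + 1) *
              (-(∑ j ∈ weilPrimeIndex a, (χ (j : ZMod q)).re * ((Λ j : ℝ) / Real.sqrt j) *
                    Real.sin (freq a (((k : ℕ) : ℤ) + 1) * Real.log j)) / π
                - (Complex.digamma (1 / 4 + ((freq a (((k : ℕ) : ℤ) + 1) : ℝ) : ℂ) / 2 * I)).im / (2 * π)
                + archExpSumSin a (((k : ℕ) : ℤ) + 1) / π))
              * ((-1 : ℝ) ^ ((k' : ℕ) + 1) *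
              (-(∑ j ∈ weilPrimeIndex a, (χ (j : ZMod q)).re * ((Λ j : ℝ) / Real.sqrt j) *
                    Real.sin (freq a (((k' : ℕ) : ℤ) + 1) * Real.log j)) / π
                - (Complex.digamma (1 / 4 + ((freq a (((k' : ℕ) : ℤ) + 1) : ℝ) : ℂ) / 2 * I)).im / (2 * π)
                + archExpSumSin a (((k' : ℕ) : ℤ) + 1) / π)))
          + (if k = k' then (1 + θ⁻¹) * (B / (d₀ * ((((B₃ : ℝ) + 1) ^ 2) * (B₃ : ℝ))))
              * (2 * ((k : ℕ) + 1 : ℕ) * (∑ j ∈ weilPrimeIndex a, (Λ j : ℝ) / Real.sqrt j) / π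
                + ((((k : ℕ) + 1 : ℕ) : ℝ) / 2 + 4 * a * (1 + weilArchDensity (2 * a)) / (3 * π ^ 2))) ^ 2
            else 0)) *ᵥ x := by
  refine (odd_twisted_tail_majorant χ ha hBB hB₃ d hd₀ hd hθ N x).trans (le_of_eq ?_)
  rw [dotProduct_rankOne_add_diag_mulVec]

end Tail

end Summit.Ventures.WeilGRH

end
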